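import Summits.Schanuel.Schanuel.Theses.TateNomes
import Literature.Barriers.Schanuel.NesterenkoModularScopeValuesProofs
import Literature.Barriers.Schanuel.NesterenkoModularScopeConjecture
import Literature.Barriers.Schanuel.NesterenkoModularScopeHolds
import Literature.Barriers.Schanuel.AlgebraicIndependenceOfLogarithms

/-!
# `TateLocusGPCOne` (crux stmt-Schanuel-17406, route `TateNomes`): CM calibration `= 3` and the
# convergence hypothesis — negative-side support (standing disprover `cdisprove-stmt-Schanuel-17406`,
# cycle 1, file 1 of 3)

`TateLocusGPCOne`: for `Im τ > 0` with `τ` not a root of a monic rational quadratic,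
`5 ≤ trdeg_ℚ ℚ(2πi, τ, q, P(q), Q(q), R(q))`, `q = e^{2πiτ}`, `P, Q, R` Ramanujan's `q`-series
(route spelling; definitionally `Literature.Barriers.Schanuel.ramanujanP/Q/R`).

This file complements `TateLocusGPCOneLoadBearing.lean` (p143528: the non-quadratic clause is
load-bearing via `R(e^{−2π}) = 0`, `trdeg ≤ 4` at `τ = i`; `6 ≤ trdeg` is false at `τ = i·2^{1/4}`).
Recorded here, sorry-free, standard axioms:

* `tateLocusGPCOne_cm_calibration` — the EXACT value at the excluded CM point `τ = i`:
  `trdeg_ℚ ℚ(2πi, i, e^{−2π}, P, Q, R) = 3`. Upper bound: `P(e^{−2π}) = E₂(i) = 3/π = 6i/(2πi)`,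
  `R(e^{−2π}) = E₆(i) = 0`, `i ∈ ℚ̄`; lower bound: Nesterenko's theorem (tree THEOREM
  `nesterenko1996_thm_1_1_holds`). So the CM deficit is exactly `2 = dim GL₂ − dim T_CM`, as the
  period conjecture predicts (`dim G_mot = 3` for `h¹(E_i) ⊕ [ℤ → 𝔾_m; e^{−2π}]`).
* `not_tateLocusGPCOne_four_without_nonQuadratic` — even the WEAKER claim `4 ≤ trdeg` is false
  once the non-quadratic clause is dropped (sharpens p143528's `≤ 4` to `= 3`): any proof must use
  non-CM for TWO degrees.
* `tateLocusGPCOne_false_without_imPos` — dropping `0 < Im τ` makes the statement false: at the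
  algebraic non-quadratic `τ₁ = −i·2^{1/4}` (lower half-plane) `|q| = e^{2π·2^{1/4}} ≥ 1`, the
  three `q`-series diverge (`not_summable_sigma_mul_pow`), Lean's `tsum` returns the junk value
  `0`, so `P = Q = R = 1` and the generators `2πi, τ₁, q, 1, 1, 1` give `trdeg ≤ 2 < 5`. (The
  hypothesis is the convergence hypothesis `|q| < 1`.)
* helpers reused by files 2–3 (`TateLocusGPCOneGenerators.lean`,
  `TateLocusGPCOneAlgebraicNome.lean`): `trdeg_adjoin_le_of_subset_range_union`,
  `trdeg_adjoin_le_of_subset_adjoin_range_union`, the quartic witness `± i·2^{1/4}`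
  (`quartic_witness_nonQuadratic`, `quartic_witness_isAlgebraic`, `tau0_im_pos`).

Nothing here refutes the crux (an instance of André's generalized period conjecture:
Bertolin–Waldschmidt arXiv:2504.14048 Conj. 2.1 at `(s,n) = (1,2)`; `dim G_mot = 5` exactly under
the hypotheses).
-/

noncomputable section

set_option linter.dupNamespace false

namespace Summit.Schanuel.Schanuel.Theorems.TateLocusGPCOne.Negative

open Complex IntermediateField Filter
open Literature.Barriers.Schanuel

/-- Sanity link: the route decl is `∀ τ, 0 < Im τ → NonQuadratic τ → 5 ≤ trdeg` of the six-set used throughout this file. -/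
example : Summit.Schanuel.Schanuel.Theses.TateNomes.TateLocusGPCOne ↔
    ∀ τ : ℂ, 0 < τ.im → (∀ b c : ℚ, τ ^ 2 + (b : ℂ) * τ + (c : ℂ) ≠ 0) →
      (5 : Cardinal) ≤ Algebra.trdeg ℚ ↥(adjoin ℚ
        ({2 * (Real.pi : ℂ) * Complex.I, τ, Complex.exp (2 * Real.pi * Complex.I * τ),
          1 - 24 * ∑' l : ℕ, (ArithmeticFunction.sigma 1 (l + 1) : ℂ) *
            Complex.exp (2 * Real.pi * Complex.I * τ) ^ (l + 1),
          1 + 240 * ∑' l : ℕ, (ArithmeticFunction.sigma 3 (l + 1) : ℂ) *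
            Complex.exp (2 * Real.pi * Complex.I * τ) ^ (l + 1),
          1 - 504 * ∑' l : ℕ, (ArithmeticFunction.sigma 5 (l + 1) : ℂ) *
            Complex.exp (2 * Real.pi * Complex.I * τ) ^ (l + 1)} : Set ℂ)) :=
  Iff.rfl

/-! ### Field-theoretic helper -/

/-- If `S ⊆ {v₀, …, v_{k−1}} ∪ T` with every element of `T` algebraic over `ℚ`, then
`trdeg_ℚ ℚ(S) ≤ k`. [folklore] -/
theorem trdeg_adjoin_le_of_subset_range_union {k : ℕ} (v : Fin k → ℂ) (T S : Set ℂ)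
    (hT : ∀ x ∈ T, IsAlgebraic ℚ x) (hS : S ⊆ Set.range v ∪ T) :
    Algebra.trdeg ℚ ↥(adjoin ℚ S) ≤ (k : Cardinal) := by
  have hle : adjoin ℚ S ≤ adjoin ℚ (Set.range v ∪ T) := adjoin.mono ℚ _ _ hS
  calc Algebra.trdeg ℚ ↥(adjoin ℚ S) ≤ Algebra.trdeg ℚ ↥(adjoin ℚ (Set.range v ∪ T)) :=
        trdeg_le_of_injective (inclusion hle) (inclusion_injective hle)
    _ = Algebra.trdeg ℚ ↥(adjoin ℚ (Set.range v)) := trdeg_adjoin_union_eq_of_isAlgebraic _ _ hT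
    _ ≤ (k : Cardinal) :=
        Literature.NumberTheory.Transcendental.Philippon1986_criterion.trdeg_adjoin_range_le v

/-- Same, with `S` only required to lie in the FIELD `ℚ({v} ∪ T)` (so that generators which are
rational expressions in the others, like `3/π = 6i/(2πi)`, can be discarded). [folklore] -/
theorem trdeg_adjoin_le_of_subset_adjoin_range_union {k : ℕ} (v : Fin k → ℂ) (T S : Set ℂ)
    (hT : ∀ x ∈ T, IsAlgebraic ℚ x) (hS : S ⊆ (adjoin ℚ (Set.range v ∪ T) : Set ℂ)) :
    Algebra.trdeg ℚ ↥(adjoin ℚ S) ≤ (k : Cardinal) := by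
  have hle : adjoin ℚ S ≤ adjoin ℚ (Set.range v ∪ T) := adjoin_le_iff.mpr hS
  calc Algebra.trdeg ℚ ↥(adjoin ℚ S) ≤ Algebra.trdeg ℚ ↥(adjoin ℚ (Set.range v ∪ T)) :=
        trdeg_le_of_injective (inclusion hle) (inclusion_injective hle)
    _ = Algebra.trdeg ℚ ↥(adjoin ℚ (Set.range v)) := trdeg_adjoin_union_eq_of_isAlgebraic _ _ hT
    _ ≤ (k : Cardinal) :=
        Literature.NumberTheory.Transcendental.Philippon1986_criterion.trdeg_adjoin_range_le v

/-! ### CM calibration at `τ = i`: the value is exactly `3` -/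

/-- `P(e^{2πi·i}) = E₂(i) = 3/π`, route spelling. -/
theorem ramanujanP_at_I :
    1 - 24 * ∑' l : ℕ, (ArithmeticFunction.sigma 1 (l + 1) : ℂ) *
      Complex.exp (2 * Real.pi * Complex.I * Complex.I) ^ (l + 1) = 3 / (Real.pi : ℂ) := by
  change ramanujanP (cexp (2 * Real.pi * I * ((UpperHalfPlane.I : UpperHalfPlane) : ℂ))) = _
  rw [ramanujanP_cexp]
  exact Literature.NumberTheory.EllipticCurves.ModularForms.E2_I

/-- `R(e^{2πi·i}) = E₆(i) = 0`, route spelling. -/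
theorem ramanujanR_at_I :
    1 - 504 * ∑' l : ℕ, (ArithmeticFunction.sigma 5 (l + 1) : ℂ) *
      Complex.exp (2 * Real.pi * Complex.I * Complex.I) ^ (l + 1) = 0 := by
  change ramanujanR (cexp (2 * Real.pi * I * ((UpperHalfPlane.I : UpperHalfPlane) : ℂ))) = 0
  rw [ramanujanR_cexp]
  exact Literature.NumberTheory.EllipticCurves.ModularForms.E₆_I

/-- Upper bound at the CM point: `trdeg ℚ(2πi, i, e^{−2π}, P, Q, R) ≤ 3` — the six generators lie
in `ℚ(2πi, q, Q)(i)`: `P = 3/π = 6i/(2πi)`, `R = 0`. -/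
theorem trdeg_six_at_I_le_three :
    Algebra.trdeg ℚ ↥(adjoin ℚ
      ({2 * (Real.pi : ℂ) * Complex.I, Complex.I, Complex.exp (2 * Real.pi * Complex.I * Complex.I),
        1 - 24 * ∑' l : ℕ, (ArithmeticFunction.sigma 1 (l + 1) : ℂ) *
          Complex.exp (2 * Real.pi * Complex.I * Complex.I) ^ (l + 1),
        1 + 240 * ∑' l : ℕ, (ArithmeticFunction.sigma 3 (l + 1) : ℂ) *
          Complex.exp (2 * Real.pi * Complex.I * Complex.I) ^ (l + 1),
        1 - 504 * ∑' l : ℕ, (ArithmeticFunction.sigma 5 (l + 1) : ℂ) *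
          Complex.exp (2 * Real.pi * Complex.I * Complex.I) ^ (l + 1)} : Set ℂ)) ≤ (3 : Cardinal) := by
  rw [ramanujanP_at_I, ramanujanR_at_I]
  have h := trdeg_adjoin_le_of_subset_adjoin_range_union
    ![2 * (Real.pi : ℂ) * Complex.I, Complex.exp (2 * Real.pi * Complex.I * Complex.I),
      1 + 240 * ∑' l : ℕ, (ArithmeticFunction.sigma 3 (l + 1) : ℂ) *
        Complex.exp (2 * Real.pi * Complex.I * Complex.I) ^ (l + 1)]
    {Complex.I, 0}
    ({2 * (Real.pi : ℂ) * Complex.I, Complex.I, Complex.exp (2 * Real.pi * Complex.I * Complex.I),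
      3 / (Real.pi : ℂ),
      1 + 240 * ∑' l : ℕ, (ArithmeticFunction.sigma 3 (l + 1) : ℂ) *
        Complex.exp (2 * Real.pi * Complex.I * Complex.I) ^ (l + 1), (0 : ℂ)} : Set ℂ)
    (by
      rintro x (rfl | hx)
      · exact isAlgebraic_I
      · rw [Set.mem_singleton_iff.mp hx]; exact isAlgebraic_zero)
    (by
      set K := adjoin ℚ (Set.range ![2 * (Real.pi : ℂ) * Complex.I,
        Complex.exp (2 * Real.pi * Complex.I * Complex.I),
        1 + 240 * ∑' l : ℕ, (ArithmeticFunction.sigma 3 (l + 1) : ℂ) *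
          Complex.exp (2 * Real.pi * Complex.I * Complex.I) ^ (l + 1)] ∪ {Complex.I, 0}) with hK
      have h2piI : 2 * (Real.pi : ℂ) * Complex.I ∈ K := subset_adjoin ℚ _ (Or.inl ⟨0, by simp⟩)
      have hq : Complex.exp (2 * Real.pi * Complex.I * Complex.I) ∈ K :=
        subset_adjoin ℚ _ (Or.inl ⟨1, by simp⟩)
      have hQ : 1 + 240 * ∑' l : ℕ, (ArithmeticFunction.sigma 3 (l + 1) : ℂ) *
          Complex.exp (2 * Real.pi * Complex.I * Complex.I) ^ (l + 1) ∈ K :=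
        subset_adjoin ℚ _ (Or.inl ⟨2, by simp⟩)
      have hI : Complex.I ∈ K := subset_adjoin ℚ _ (Or.inr (Set.mem_insert _ _))
      have hP : (3 / (Real.pi : ℂ)) ∈ K := by
        have hπ : (Real.pi : ℂ) ≠ 0 := ofReal_ne_zero.mpr Real.pi_ne_zero
        have e : (3 / (Real.pi : ℂ)) = ((6 : ℕ) : ℂ) * Complex.I / (2 * (Real.pi : ℂ) * Complex.I) := by
          push_cast
          field_simp
          ring
        rw [e]
        exact div_mem (mul_mem (IntermediateField.natCast_mem K 6) hI) h2piI
      intro x hx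
      simp only [Set.mem_insert_iff, Set.mem_singleton_iff] at hx
      rcases hx with rfl | rfl | rfl | rfl | rfl | rfl
      · exact h2piI
      · exact hI
      · exact hq
      · exact hP
      · exact hQ
      · exact zero_mem K)
  exact_mod_cast h

/-- Lower bound at the CM point from **Nesterenko's theorem** (tree theorem
`nesterenko1996_thm_1_1_holds`): already `q, P, Q, R` give `3`. -/
theorem three_le_trdeg_six_at_I :
    (3 : Cardinal) ≤ Algebra.trdeg ℚ ↥(adjoin ℚ
      ({2 * (Real.pi : ℂ) * Complex.I, Complex.I, Complex.exp (2 * Real.pi * Complex.I * Complex.I),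
        1 - 24 * ∑' l : ℕ, (ArithmeticFunction.sigma 1 (l + 1) : ℂ) *
          Complex.exp (2 * Real.pi * Complex.I * Complex.I) ^ (l + 1),
        1 + 240 * ∑' l : ℕ, (ArithmeticFunction.sigma 3 (l + 1) : ℂ) *
          Complex.exp (2 * Real.pi * Complex.I * Complex.I) ^ (l + 1),
        1 - 504 * ∑' l : ℕ, (ArithmeticFunction.sigma 5 (l + 1) : ℂ) *
          Complex.exp (2 * Real.pi * Complex.I * Complex.I) ^ (l + 1)} : Set ℂ)) := by
  have h3 := three_le_trdeg_adjoin_of_thm_1_1 nesterenko1996_thm_1_1_holds Complex.I (by simp)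
  have hle : adjoin ℚ ({cexp (2 * Real.pi * I * Complex.I), ramanujanP (cexp (2 * Real.pi * I * Complex.I)),
      ramanujanQ (cexp (2 * Real.pi * I * Complex.I)), ramanujanR (cexp (2 * Real.pi * I * Complex.I))} : Set ℂ)
      ≤ adjoin ℚ ({2 * (Real.pi : ℂ) * Complex.I, Complex.I, Complex.exp (2 * Real.pi * Complex.I * Complex.I),
          1 - 24 * ∑' l : ℕ, (ArithmeticFunction.sigma 1 (l + 1) : ℂ) *
            Complex.exp (2 * Real.pi * Complex.I * Complex.I) ^ (l + 1),
          1 + 240 * ∑' l : ℕ, (ArithmeticFunction.sigma 3 (l + 1) : ℂ) *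
            Complex.exp (2 * Real.pi * Complex.I * Complex.I) ^ (l + 1),
          1 - 504 * ∑' l : ℕ, (ArithmeticFunction.sigma 5 (l + 1) : ℂ) *
            Complex.exp (2 * Real.pi * Complex.I * Complex.I) ^ (l + 1)} : Set ℂ) := by
    refine adjoin.mono ℚ _ _ ?_
    intro x hx
    simp only [Set.mem_insert_iff, Set.mem_singleton_iff] at hx
    rcases hx with rfl | rfl | rfl | rfl
    · exact Or.inr (Or.inr (Or.inl rfl))
    · exact Or.inr (Or.inr (Or.inr (Or.inl rfl)))
    · exact Or.inr (Or.inr (Or.inr (Or.inr (Or.inl rfl))))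
    · exact Or.inr (Or.inr (Or.inr (Or.inr (Or.inr rfl))))
  exact h3.trans (trdeg_le_of_injective (inclusion hle) (inclusion_injective hle))

/-- **CM calibration** (PROVED): at the excluded CM point `τ = i`,
`trdeg_ℚ ℚ(2πi, i, e^{−2π}, P(e^{−2π}), Q(e^{−2π}), R(e^{−2π})) = 3` — exactly two below the crux's
claim, matching `dim G_mot = 3` of the CM 1-motive. Upper bound: `E₂(i) = 3/π`, `E₆(i) = 0`;
lower bound: Nesterenko 1996. -/
theorem tateLocusGPCOne_cm_calibration :
    Algebra.trdeg ℚ ↥(adjoin ℚ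
      ({2 * (Real.pi : ℂ) * Complex.I, Complex.I, Complex.exp (2 * Real.pi * Complex.I * Complex.I),
        1 - 24 * ∑' l : ℕ, (ArithmeticFunction.sigma 1 (l + 1) : ℂ) *
          Complex.exp (2 * Real.pi * Complex.I * Complex.I) ^ (l + 1),
        1 + 240 * ∑' l : ℕ, (ArithmeticFunction.sigma 3 (l + 1) : ℂ) *
          Complex.exp (2 * Real.pi * Complex.I * Complex.I) ^ (l + 1),
        1 - 504 * ∑' l : ℕ, (ArithmeticFunction.sigma 5 (l + 1) : ℂ) *
          Complex.exp (2 * Real.pi * Complex.I * Complex.I) ^ (l + 1)} : Set ℂ)) = 3 :=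
  le_antisymm trdeg_six_at_I_le_three three_le_trdeg_six_at_I

/-- **Even `4 ≤ trdeg` fails without the non-quadratic clause** (witness `τ = i`, value `3`):
the CM exclusion is worth two full degrees, not one. -/
theorem not_tateLocusGPCOne_four_without_nonQuadratic :
    ¬ (∀ τ : ℂ, 0 < τ.im → (4 : Cardinal) ≤ Algebra.trdeg ℚ ↥(adjoin ℚ
        ({2 * (Real.pi : ℂ) * Complex.I, τ, Complex.exp (2 * Real.pi * Complex.I * τ),
          1 - 24 * ∑' l : ℕ, (ArithmeticFunction.sigma 1 (l + 1) : ℂ) *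
            Complex.exp (2 * Real.pi * Complex.I * τ) ^ (l + 1),
          1 + 240 * ∑' l : ℕ, (ArithmeticFunction.sigma 3 (l + 1) : ℂ) *
            Complex.exp (2 * Real.pi * Complex.I * τ) ^ (l + 1),
          1 - 504 * ∑' l : ℕ, (ArithmeticFunction.sigma 5 (l + 1) : ℂ) *
            Complex.exp (2 * Real.pi * Complex.I * τ) ^ (l + 1)} : Set ℂ))) := by
  intro h
  have h4 := h Complex.I (by simp)
  rw [tateLocusGPCOne_cm_calibration] at h4
  norm_num at h4

/-! ### The witness `τ₀ = i·2^{1/4}` (algebraic, non-quadratic, upper half-plane) and its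
conjugate `τ₁ = −i·2^{1/4}` (lower half-plane) -/

/-- `(± i·2^{1/4})² = −√2`. -/
theorem quartic_witness_sq (s : ℝ) (hs : s * s = Real.sqrt 2) :
    (Complex.mk 0 s) ^ 2 = -((Real.sqrt 2 : ℝ) : ℂ) := by
  apply Complex.ext
  · simp [sq, hs]
  · simp [sq]

/-- `± i·2^{1/4}` is not a root of a monic rational quadratic (real parts: `c = √2 ∉ ℚ`). -/
theorem quartic_witness_nonQuadratic (s : ℝ) (hs : s * s = Real.sqrt 2) :
    ∀ b c : ℚ, (Complex.mk 0 s) ^ 2 + (b : ℂ) * (Complex.mk 0 s) + (c : ℂ) ≠ 0 := by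
  intro b c h
  rw [quartic_witness_sq s hs] at h
  have hre := congrArg Complex.re h
  simp only [Complex.add_re, Complex.neg_re, Complex.ofReal_re, Complex.mul_re,
    Complex.ratCast_re, Complex.ratCast_im, Complex.zero_re] at hre
  have hc : (c : ℝ) = Real.sqrt 2 := by linarith
  exact irrational_sqrt_two ⟨c, hc⟩

/-- `± i·2^{1/4}` is algebraic (a root of `X⁴ − 2`). -/
theorem quartic_witness_isAlgebraic (s : ℝ) (hs : s * s = Real.sqrt 2) :
    IsAlgebraic ℚ (Complex.mk 0 s) := by
  refine ⟨Polynomial.X ^ 4 - 2, fun h => ?_, ?_⟩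
  · have h0 := congrArg (Polynomial.eval 0) h
    norm_num at h0
  · simp only [map_sub, map_pow, Polynomial.aeval_X, map_ofNat]
    rw [show (Complex.mk 0 s) ^ 4 = ((Complex.mk 0 s) ^ 2) ^ 2 by ring, quartic_witness_sq s hs,
      neg_sq, ← Complex.ofReal_pow, Real.sq_sqrt zero_le_two]
    norm_num

/-- `s₀ = 2^{1/4}` satisfies `s₀² = √2`. -/
theorem sqrt_sqrt_two_mul_self : Real.sqrt (Real.sqrt 2) * Real.sqrt (Real.sqrt 2) = Real.sqrt 2 :=
  Real.mul_self_sqrt (Real.sqrt_nonneg 2)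

/-- `(-s₀)² = √2` as well. -/
theorem neg_sqrt_sqrt_two_mul_self :
    (-Real.sqrt (Real.sqrt 2)) * (-Real.sqrt (Real.sqrt 2)) = Real.sqrt 2 := by
  rw [neg_mul_neg]; exact sqrt_sqrt_two_mul_self

/-- `Im τ₀ = 2^{1/4} > 0`. -/
theorem tau0_im_pos : 0 < Complex.im (Complex.mk 0 (Real.sqrt (Real.sqrt 2))) :=
  Real.sqrt_pos.mpr (Real.sqrt_pos.mpr two_pos)

/-! ### Dropping `0 < Im τ`: divergent `q`-series, junk `tsum`, statement false -/

/-- `σ_k(n) ≥ 1` for `n ≥ 1` (the divisor `1`). [folklore] -/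
theorem one_le_sigma_of_ne_zero (k : ℕ) {n : ℕ} (hn : n ≠ 0) :
    1 ≤ ArithmeticFunction.sigma k n := by
  rw [ArithmeticFunction.sigma_apply]
  calc 1 = 1 ^ k := (one_pow k).symm
    _ ≤ ∑ d ∈ n.divisors, d ^ k :=
        Finset.single_le_sum (f := fun d => d ^ k) (fun _ _ => Nat.zero_le _)
          (Nat.one_mem_divisors.mpr hn)

/-- For `|q| ≥ 1` the series `∑ σ_k(n) qⁿ` diverges (its terms have norm `≥ 1`). [folklore] -/
theorem not_summable_sigma_mul_pow (k : ℕ) {q : ℂ} (hq : 1 ≤ ‖q‖) :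
    ¬ Summable (fun l : ℕ => (ArithmeticFunction.sigma k (l + 1) : ℂ) * q ^ (l + 1)) := by
  intro hs
  have ht := hs.tendsto_atTop_zero
  have hev : ∀ᶠ l : ℕ in atTop,
      ‖(ArithmeticFunction.sigma k (l + 1) : ℂ) * q ^ (l + 1)‖ < 1 := by
    have := (NormedAddGroup.tendsto_nhds_zero.1 ht) 1 one_pos
    exact this
  obtain ⟨l, hl⟩ := hev.exists
  have hge : (1 : ℝ) ≤ ‖(ArithmeticFunction.sigma k (l + 1) : ℂ) * q ^ (l + 1)‖ := by
    rw [norm_mul, norm_pow, Complex.norm_natCast]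
    have h1 : (1 : ℝ) ≤ (ArithmeticFunction.sigma k (l + 1) : ℝ) := by
      exact_mod_cast one_le_sigma_of_ne_zero k (Nat.succ_ne_zero l)
    have h2 : (1 : ℝ) ≤ ‖q‖ ^ (l + 1) := one_le_pow₀ hq
    nlinarith
  linarith

/-- At `τ₁ = −i·2^{1/4}` the nome is `q = e^{2π·2^{1/4}}`, of norm `≥ 1`. -/
theorem one_le_norm_nome_tau1 :
    1 ≤ ‖Complex.exp (2 * Real.pi * Complex.I * (Complex.mk 0 (-Real.sqrt (Real.sqrt 2))))‖ := by
  rw [Complex.norm_exp]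
  have hre : (2 * Real.pi * Complex.I * (Complex.mk 0 (-Real.sqrt (Real.sqrt 2)))).re =
      2 * Real.pi * Real.sqrt (Real.sqrt 2) := by
    simp [Complex.mul_re, Complex.mul_im]
  rw [hre]
  exact Real.one_le_exp (by positivity)

/-- **Dropping `0 < Im τ` makes `TateLocusGPCOne` false** (witness `τ₁ = −i·2^{1/4}`: algebraic,
non-quadratic, `|q| > 1`, the three `q`-series diverge and `tsum` returns `0`, so the generators
are `2πi, τ₁, q, 1, 1, 1` and `trdeg ≤ 2 < 5`). The hypothesis is the convergence hypothesis. -/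
theorem tateLocusGPCOne_false_without_imPos :
    ¬ (∀ τ : ℂ, (∀ b c : ℚ, τ ^ 2 + (b : ℂ) * τ + (c : ℂ) ≠ 0) →
      (5 : Cardinal) ≤ Algebra.trdeg ℚ ↥(adjoin ℚ
        ({2 * (Real.pi : ℂ) * Complex.I, τ, Complex.exp (2 * Real.pi * Complex.I * τ),
          1 - 24 * ∑' l : ℕ, (ArithmeticFunction.sigma 1 (l + 1) : ℂ) *
            Complex.exp (2 * Real.pi * Complex.I * τ) ^ (l + 1),
          1 + 240 * ∑' l : ℕ, (ArithmeticFunction.sigma 3 (l + 1) : ℂ) *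
            Complex.exp (2 * Real.pi * Complex.I * τ) ^ (l + 1),
          1 - 504 * ∑' l : ℕ, (ArithmeticFunction.sigma 5 (l + 1) : ℂ) *
            Complex.exp (2 * Real.pi * Complex.I * τ) ^ (l + 1)} : Set ℂ))) := by
  intro h
  set τ₁ : ℂ := Complex.mk 0 (-Real.sqrt (Real.sqrt 2)) with hτ₁
  have h5 := h τ₁ (quartic_witness_nonQuadratic _ neg_sqrt_sqrt_two_mul_self)
  have hP := tsum_eq_zero_of_not_summable (not_summable_sigma_mul_pow 1 one_le_norm_nome_tau1)
  have hQ := tsum_eq_zero_of_not_summable (not_summable_sigma_mul_pow 3 one_le_norm_nome_tau1)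
  have hR := tsum_eq_zero_of_not_summable (not_summable_sigma_mul_pow 5 one_le_norm_nome_tau1)
  rw [hP, hQ, hR] at h5
  have h2 := trdeg_adjoin_le_of_subset_range_union
    ![2 * (Real.pi : ℂ) * Complex.I, Complex.exp (2 * Real.pi * Complex.I * τ₁)]
    {τ₁, 1 - 24 * 0, 1 + 240 * 0, 1 - 504 * 0}
    ({2 * (Real.pi : ℂ) * Complex.I, τ₁, Complex.exp (2 * Real.pi * Complex.I * τ₁),
      1 - 24 * 0, 1 + 240 * 0, 1 - 504 * 0} : Set ℂ)
    (by
      rintro x (rfl | rfl | rfl | hx)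
      · exact quartic_witness_isAlgebraic _ neg_sqrt_sqrt_two_mul_self
      · norm_num; exact isAlgebraic_one
      · norm_num; exact isAlgebraic_one
      · rw [Set.mem_singleton_iff.mp hx]; norm_num; exact isAlgebraic_one)
    (by
      intro x hx
      simp only [Set.mem_insert_iff, Set.mem_singleton_iff] at hx
      rcases hx with rfl | rfl | rfl | rfl | rfl | rfl
      · exact Or.inl ⟨0, by simp⟩
      · exact Or.inr (Or.inl rfl)
      · exact Or.inl ⟨1, by simp⟩
      · exact Or.inr (Or.inr (Or.inl rfl))
      · exact Or.inr (Or.inr (Or.inr (Or.inl rfl)))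
      · exact Or.inr (Or.inr (Or.inr (Or.inr rfl))))
  have : (5 : Cardinal) ≤ 2 := h5.trans (by exact_mod_cast h2)
  norm_num at this

end Summit.Schanuel.Schanuel.Theorems.TateLocusGPCOne.Negative

end
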